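import Summits.Ventures.Crystal3D.Theorems.StickyWulffConstantNoReconstructionGainCapCounts
import HarnessLib

/-!
# Cap counts, sharpened: the corner test made public, and the entries `0.535 ↦ 4`, `0.28 ↦ 5`
# (crux `NoReconstructionGain`, stmt-Ventures-19144, line `replication-exactness`, inside `stub_noCriminal`)

HONEST FRAMING. Part of the venture `Summits/Ventures/Crystal3D` (cell `crystal3d-full`), helper `--supports` the
crux `NoReconstructionGain` (stmt-Ventures-19144, route `route-Ventures-StickyWulffConstant`), lead wulff-p1 g24.
Spherical-code building blocks (continuation of `…NoReconstructionGainCapCounts`, whose corner-test machinery was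
private); nothing about films; the crux is not moved.

* `concaveQuad_nonneg_Icc`, `le_mul_sqrt_of_sq_le`, `pairSq_bound_of_corners`, `sqrt_twoThirds_bounds`,
  **`card_cap_le_of_cornerTest`** — PUBLIC versions of the tools of `…CapCounts`: to bound
  `#{u ∈ F : t ≤ u₂ ≤ √(2/3)} ≤ m` for a `60°`-code `F` it suffices to exhibit `κ ≥ 0` with
  `(m+1)·arccos κ > 2π` and to check `G(z,z') := κ²(1−z²)(1−z'²) − (1/2 − zz')² ≥ 0` at the four corners
  `(t,t), (0.71,t), (t,c), (0.71,c)` (`G` is a concave quadratic in each variable; on `[0.71, c]²` the product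
  `zz'` exceeds `1/2`).
* `card_cap_ge_0535_le_four` (`t = 0.535`: at most `4`; `cos(2π/5) = (√5−1)/4 > 61/200`) and
  `card_cap_ge_028_le_five` (`t = 0.28`: at most `5`; `κ = 99/200 < 1/2`) — the sharper entries the seven-partner
  top row needs (true thresholds `≈ 0.5257`, `≈ 0.27`).

WHAT THIS IS NOT: no height-sum or film statement; rung F-C1 not moved.
-/

noncomputable section

namespace Summit.Ventures.Crystal3D.Theorems

open Finset Real
open scoped InnerProductSpace

/-- A concave quadratic that is non-negative at the ends of an interval is non-negative on it. -/
theorem concaveQuad_nonneg_Icc {A B C t s x : ℝ} (hC : 0 ≤ C) (htx : t ≤ x) (hxs : x ≤ s)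
    (ht : 0 ≤ A + B * t - C * t ^ 2) (hs : 0 ≤ A + B * s - C * s ^ 2) : 0 ≤ A + B * x - C * x ^ 2 := by
  have key : (s - t) * (A + B * x - C * x ^ 2) =
      (s - x) * (A + B * t - C * t ^ 2) + (x - t) * (A + B * s - C * s ^ 2) + C * ((x - t) * (s - x)) * (s - t) := by
    ring
  rcases eq_or_lt_of_le (htx.trans hxs) with hts | hts
  · have hxt : x = t := le_antisymm (hts ▸ hxs) htx
    rw [hxt]; exact ht
  · have hprod : 0 ≤ (s - x) * (A + B * t - C * t ^ 2) + (x - t) * (A + B * s - C * s ^ 2) +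
        C * ((x - t) * (s - x)) * (s - t) := by
      have h1 := mul_nonneg (sub_nonneg.2 hxs) ht
      have h2 := mul_nonneg (sub_nonneg.2 htx) hs
      have h3 := mul_nonneg (mul_nonneg hC (mul_nonneg (sub_nonneg.2 htx) (sub_nonneg.2 hxs))) (sub_pos.2 hts).le
      linarith
    rw [← key] at hprod
    by_contra hneg
    push Not at hneg
    exact absurd hprod (not_le.2 (mul_neg_of_pos_of_neg (sub_pos.2 hts) hneg))

/-- Squaring step: if `L ≤ 0` or `L² ≤ κ² (1−z²)(1−z'²)` with `κ ≥ 0`, then `L ≤ κ √(1−z²) √(1−z'²)`. -/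
theorem le_mul_sqrt_of_sq_le {L κ z z' : ℝ} (hκ : 0 ≤ κ) (hz : z ^ 2 ≤ 1) (hz' : z' ^ 2 ≤ 1)
    (h : L ≤ 0 ∨ L ^ 2 ≤ κ ^ 2 * ((1 - z ^ 2) * (1 - z' ^ 2))) :
    L ≤ κ * (Real.sqrt (1 - z ^ 2) * Real.sqrt (1 - z' ^ 2)) := by
  have hX : 0 ≤ 1 - z ^ 2 := by linarith
  have hY : 0 ≤ 1 - z' ^ 2 := by linarith
  have hR : 0 ≤ κ * (Real.sqrt (1 - z ^ 2) * Real.sqrt (1 - z' ^ 2)) := by positivity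
  rcases h with h | h
  · exact h.trans hR
  · by_cases hL : L ≤ 0
    · exact hL.trans hR
    · push Not at hL
      rw [← pow_le_pow_iff_left₀ hL.le hR two_ne_zero]
      calc L ^ 2 ≤ κ ^ 2 * ((1 - z ^ 2) * (1 - z' ^ 2)) := h
        _ = (κ * (Real.sqrt (1 - z ^ 2) * Real.sqrt (1 - z' ^ 2))) ^ 2 := by
          rw [mul_pow, mul_pow, Real.sq_sqrt hX, Real.sq_sqrt hY]

/-- **Corner test for the squared pair bound.**  With `G(z,z') := κ²(1−z²)(1−z'²) − (1/2 − zz')²` (a concave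
quadratic in each variable separately), non-negativity of `G` at the four corners `(t,t), (s,t), (t,c), (s,c)`,
`s = 71/100`, `c = √(2/3)`, gives for all `z, z' ∈ [t, c]`: `1/2 − zz' ≤ 0` or `(1/2 − zz')² ≤ κ²(1−z²)(1−z'²)`
(on `[s, c]²` the product `zz'` exceeds `1/2`). -/
theorem pairSq_bound_of_corners {t κ : ℝ} (ht0 : 0 ≤ t)
    (h_tt : 0 ≤ κ ^ 2 * ((1 - t ^ 2) * (1 - t ^ 2)) - (1 / 2 - t * t) ^ 2)
    (h_st : 0 ≤ κ ^ 2 * ((1 - (71 / 100) ^ 2) * (1 - t ^ 2)) - (1 / 2 - 71 / 100 * t) ^ 2)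
    (h_tc : 0 ≤ κ ^ 2 * ((1 - t ^ 2) * (1 - Real.sqrt (2 / 3) ^ 2)) - (1 / 2 - t * Real.sqrt (2 / 3)) ^ 2)
    (h_sc : 0 ≤ κ ^ 2 * ((1 - (71 / 100) ^ 2) * (1 - Real.sqrt (2 / 3) ^ 2)) -
      (1 / 2 - 71 / 100 * Real.sqrt (2 / 3)) ^ 2)
    {z z' : ℝ} (hz : t ≤ z) (hzc : z ≤ Real.sqrt (2 / 3)) (hz' : t ≤ z') (hz'c : z' ≤ Real.sqrt (2 / 3)) :
    1 / 2 - z * z' ≤ 0 ∨ (1 / 2 - z * z') ^ 2 ≤ κ ^ 2 * ((1 - z ^ 2) * (1 - z' ^ 2)) := by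
  set c : ℝ := Real.sqrt (2 / 3) with hc
  have hc2 : c ^ 2 = 2 / 3 := Real.sq_sqrt (by norm_num)
  have hcpos : 0 < c := Real.sqrt_pos.2 (by norm_num)
  have hsc : (71 / 100 : ℝ) ≤ c := by nlinarith
  set s : ℝ := 71 / 100 with hs
  -- `G(x, y)` as a concave quadratic in `y`: `A x + x·y − C x · y²`
  have hG : ∀ x y : ℝ, κ ^ 2 * ((1 - x ^ 2) * (1 - y ^ 2)) - (1 / 2 - x * y) ^ 2 =
      (κ ^ 2 * (1 - x ^ 2) - 1 / 4) + x * y - (κ ^ 2 * (1 - x ^ 2) + x ^ 2) * y ^ 2 := by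
    intro x y; ring
  have hCx : ∀ x : ℝ, 0 ≤ x → x ≤ c → 0 ≤ κ ^ 2 * (1 - x ^ 2) + x ^ 2 := by
    intro x hx0 hx
    have : x ^ 2 ≤ 1 := by nlinarith [hc2]
    nlinarith [sq_nonneg κ, sq_nonneg x, mul_nonneg (sq_nonneg κ) (sub_nonneg.2 this)]
  -- one-variable step: `G(x, t) ≥ 0` and `G(x, c) ≥ 0` for `x ∈ [t, s]`
  have hGxt : ∀ x, t ≤ x → x ≤ s → 0 ≤ κ ^ 2 * ((1 - x ^ 2) * (1 - t ^ 2)) - (1 / 2 - x * t) ^ 2 := by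
    intro x hx hxs
    have e : ∀ x : ℝ, κ ^ 2 * ((1 - x ^ 2) * (1 - t ^ 2)) - (1 / 2 - x * t) ^ 2 =
        (κ ^ 2 * (1 - t ^ 2) - 1 / 4) + t * x - (κ ^ 2 * (1 - t ^ 2) + t ^ 2) * x ^ 2 := by intro x; ring
    rw [e]
    refine concaveQuad_nonneg_Icc (hCx t ht0 (by linarith)) hx hxs ?_ ?_
    · rw [← e]; exact h_tt
    · rw [← e]; exact h_st
  have hGxc : ∀ x, t ≤ x → x ≤ s → 0 ≤ κ ^ 2 * ((1 - x ^ 2) * (1 - c ^ 2)) - (1 / 2 - x * c) ^ 2 := by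
    intro x hx hxs
    have e : ∀ x : ℝ, κ ^ 2 * ((1 - x ^ 2) * (1 - c ^ 2)) - (1 / 2 - x * c) ^ 2 =
        (κ ^ 2 * (1 - c ^ 2) - 1 / 4) + c * x - (κ ^ 2 * (1 - c ^ 2) + c ^ 2) * x ^ 2 := by intro x; ring
    rw [e]
    refine concaveQuad_nonneg_Icc (hCx c hcpos.le le_rfl) hx hxs ?_ ?_
    · rw [← e]; exact h_tc
    · rw [← e]; exact h_sc
  -- two-variable step
  have hbox : ∀ x y, t ≤ x → x ≤ s → t ≤ y → y ≤ c →
      0 ≤ κ ^ 2 * ((1 - x ^ 2) * (1 - y ^ 2)) - (1 / 2 - x * y) ^ 2 := by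
    intro x y hx hxs hy hyc
    rw [hG]
    refine concaveQuad_nonneg_Icc (hCx x (by linarith) (by linarith)) hy hyc ?_ ?_
    · rw [← hG]; exact hGxt x hx hxs
    · rw [← hG]; exact hGxc x hx hxs
  by_cases h1 : z ≤ s
  · right; linarith [hbox z z' hz h1 hz' hz'c]
  by_cases h2 : z' ≤ s
  · right
    have := hbox z' z hz' h2 hz hzc
    have e : κ ^ 2 * ((1 - z' ^ 2) * (1 - z ^ 2)) - (1 / 2 - z' * z) ^ 2 =
        κ ^ 2 * ((1 - z ^ 2) * (1 - z' ^ 2)) - (1 / 2 - z * z') ^ 2 := by ring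
    linarith [e]
  · left
    push Not at h1 h2
    rw [hs] at h1 h2
    nlinarith

/-- `0.8164 < √(2/3) < 0.8166`. -/
theorem sqrt_twoThirds_bounds : (8164 / 10000 : ℝ) < Real.sqrt (2 / 3) ∧ Real.sqrt (2 / 3) < 8166 / 10000 := by
  constructor
  · rw [show (8164 / 10000 : ℝ) = Real.sqrt ((8164 / 10000) ^ 2) by rw [Real.sqrt_sq (by norm_num)]]
    exact Real.sqrt_lt_sqrt (by norm_num) (by norm_num)
  · rw [show (8166 / 10000 : ℝ) = Real.sqrt ((8166 / 10000) ^ 2) by rw [Real.sqrt_sq (by norm_num)]]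
    exact Real.sqrt_lt_sqrt (by norm_num) (by norm_num)

/-- The generic table entry: corner test ⇒ pair bound ⇒ count. -/
theorem card_cap_le_of_cornerTest (F : Finset (EuclideanSpace ℝ (Fin 3))) (h1 : ∀ u ∈ F, ‖u‖ = 1)
    (h2 : ∀ u ∈ F, ∀ v ∈ F, u ≠ v → ⟪u, v⟫_ℝ ≤ 1 / 2) {t κ : ℝ} {m : ℕ} (ht0 : 0 ≤ t)
    (hκ : 0 ≤ κ) (hm : 2 * π < (m + 1) * Real.arccos κ)
    (h_tt : 0 ≤ κ ^ 2 * ((1 - t ^ 2) * (1 - t ^ 2)) - (1 / 2 - t * t) ^ 2)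
    (h_st : 0 ≤ κ ^ 2 * ((1 - (71 / 100) ^ 2) * (1 - t ^ 2)) - (1 / 2 - 71 / 100 * t) ^ 2)
    (h_tc : 0 ≤ κ ^ 2 * ((1 - t ^ 2) * (1 - Real.sqrt (2 / 3) ^ 2)) - (1 / 2 - t * Real.sqrt (2 / 3)) ^ 2)
    (h_sc : 0 ≤ κ ^ 2 * ((1 - (71 / 100) ^ 2) * (1 - Real.sqrt (2 / 3) ^ 2)) -
      (1 / 2 - 71 / 100 * Real.sqrt (2 / 3)) ^ 2) :
    (F.filter fun u => t ≤ u 2 ∧ u 2 ≤ Real.sqrt (2 / 3)).card ≤ m := by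
  have hc2 : Real.sqrt (2 / 3) ^ 2 = 2 / 3 := Real.sq_sqrt (by norm_num)
  refine card_cap_le_of_pairBound F h1 h2 t κ m hm (fun z z' hz hzc hz' hz'c => ?_) (by linarith)
  exact le_mul_sqrt_of_sq_le hκ (by nlinarith) (by nlinarith)
    (pairSq_bound_of_corners ht0 h_tt h_st h_tc h_sc hz hzc hz' hz'c)

/-- `cos (2π/5) = (√5 − 1)/4 > 61/200`. -/
theorem cos_two_pi_div_five_gt : (61 / 200 : ℝ) < Real.cos (2 * π / 5) := by
  have h : Real.cos (2 * π / 5) = 2 * Real.cos (π / 5) ^ 2 - 1 := by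
    rw [show 2 * π / 5 = 2 * (π / 5) by ring, Real.cos_two_mul]
  rw [h, Real.cos_pi_div_five]
  have h5 : Real.sqrt 5 ^ 2 = 5 := Real.sq_sqrt (by norm_num)
  have h5' : (2221 / 1000 : ℝ) < Real.sqrt 5 := by
    rw [show (2221 / 1000 : ℝ) = Real.sqrt ((2221 / 1000) ^ 2) by rw [Real.sqrt_sq (by norm_num)]]
    exact Real.sqrt_lt_sqrt (by norm_num) (by norm_num)
  nlinarith [h5, h5']

/-- **At most four code vectors with `0.535 ≤ u₂ ≤ √(2/3)`.** -/
theorem card_cap_ge_0535_le_four (F : Finset (EuclideanSpace ℝ (Fin 3))) (h1 : ∀ u ∈ F, ‖u‖ = 1)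
    (h2 : ∀ u ∈ F, ∀ v ∈ F, u ≠ v → ⟪u, v⟫_ℝ ≤ 1 / 2) :
    (F.filter fun u => (107 / 200 : ℝ) ≤ u 2 ∧ u 2 ≤ Real.sqrt (2 / 3)).card ≤ 4 := by
  have hc2 : Real.sqrt (2 / 3) ^ 2 = 2 / 3 := Real.sq_sqrt (by norm_num)
  obtain ⟨hcl, hcu⟩ := sqrt_twoThirds_bounds
  have hκ : 2 * π < ((4 : ℕ) + 1 : ℝ) * Real.arccos (61 / 200) := by
    have h : 2 * π / 5 < Real.arccos (61 / 200) := by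
      have h0 : 0 ≤ 2 * π / 5 := by positivity
      have hπ' : 2 * π / 5 ≤ π := by linarith [pi_pos]
      rw [← Real.arccos_cos h0 hπ']
      exact Real.strictAntiOn_arccos ⟨by norm_num, by norm_num⟩
        ⟨by linarith [Real.neg_one_le_cos (2 * π / 5)], Real.cos_le_one _⟩ cos_two_pi_div_five_gt
    push_cast; linarith
  refine card_cap_le_of_cornerTest F h1 h2 (by norm_num) (by norm_num) hκ ?_ ?_ ?_ ?_
  · norm_num
  · norm_num
  · rw [hc2]; nlinarith
  · rw [hc2]; nlinarith

/-- **At most five code vectors with `0.28 ≤ u₂ ≤ √(2/3)`.** -/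
theorem card_cap_ge_028_le_five (F : Finset (EuclideanSpace ℝ (Fin 3))) (h1 : ∀ u ∈ F, ‖u‖ = 1)
    (h2 : ∀ u ∈ F, ∀ v ∈ F, u ≠ v → ⟪u, v⟫_ℝ ≤ 1 / 2) :
    (F.filter fun u => (7 / 25 : ℝ) ≤ u 2 ∧ u 2 ≤ Real.sqrt (2 / 3)).card ≤ 5 := by
  have hc2 : Real.sqrt (2 / 3) ^ 2 = 2 / 3 := Real.sq_sqrt (by norm_num)
  obtain ⟨hcl, hcu⟩ := sqrt_twoThirds_bounds
  have hκ : 2 * π < ((5 : ℕ) + 1 : ℝ) * Real.arccos (99 / 200) := by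
    have h : π / 3 < Real.arccos (99 / 200) := by
      have h0 : 0 ≤ π / 3 := by positivity
      have hπ' : π / 3 ≤ π := by linarith [pi_pos]
      rw [← Real.arccos_cos h0 hπ', Real.cos_pi_div_three]
      exact Real.strictAntiOn_arccos ⟨by norm_num, by norm_num⟩ ⟨by norm_num, by norm_num⟩ (by norm_num)
    push_cast; linarith
  refine card_cap_le_of_cornerTest F h1 h2 (by norm_num) (by norm_num) hκ ?_ ?_ ?_ ?_
  · norm_num
  · norm_num
  · rw [hc2]; nlinarith
  · rw [hc2]; nlinarith

end Summit.Ventures.Crystal3D.Theorems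

end
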